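import Literature.Analysis.FluidPDE.FluidComputer.HelicalDecomposition
import Literature.Analysis.FluidPDE.FluidComputer.ClassicalLatticeSpectra
import HarnessLib

/-!
# Purely helical modes are Beltrami modes; self-curl (Beltrami) fields — e.g. the ABC datum — are homochiral

Analysis/FluidPDE (FluidComputer vocabulary) proof file (theorems only; no definitions, no named facts),
a companion of `HelicalDecomposition.lean` (`helicalPart s û`, the Waleffe / Lei–Lin–Zhou helical
components `û±`). HONEST FRAMING as there: statements about real incompressible coefficient fields on
`ℤ³`; nothing about the Navier–Stokes PDE.

## What is printed

Biferale–Titi 2013, §2 [held: arXiv:1303.1215 p. 4]: the helical components are the projections on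
"the eigenvectors of the curl operator `ik × h±(k) = ±k h±(k)`", each "bringing a definite sign of
helicity"; "if the initial velocity configuration is chosen with only positive helicity components,
i.e. `v⁻(·, t=0) = 0`…" (the homochiral class). A field with `û⁻ ≡ 0` has `ik × û = |k| û` mode by
mode, i.e. on a single shell `|k| = λ` it is a BELTRAMI field `∇ × u = λu`; the ABC flows
(`∇ × u = u`, Frisch 1995 (9.4); tree `ABCHat.curl_abc_coeff`) are the classical examples — the
"maximal helicity" states `|H(k)| = 2|k|E(k)` of `EnergyParseval.abs_modalHelicity_le`
(tree: `ABCHat.modalHelicity_abc`).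

## What is here

* `helicalPart_coeff_eq_zero_iff_curl_eq` — for `k ≠ 0` and `s·s = 1`: **the mode `û(k)` has no
  `(−s)`-component iff it is a Beltrami mode of sign `s`, `ik × û(k) = s|k| û(k)`**;
* `helicalPart_neg_one_coeff_eq_zero_of_curl_eq_self` — a SELF-CURL coefficient field
  (`curl V = V` coefficientwise, the hypothesis of `BeltramiDecay`) is homochiral: `V̂₋ ≡ 0`
  (such a field lives on the unit shell, where `|k| = 1`);
* `ABCHat.helicalPart_neg_one_abc`, `ABCHat.helicalPart_one_abc` — **the ABC datum is purely
  positively helical**: `(abc)₋ = 0`, `(abc)₊ = abc`.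

For nsreg-p1's S20 «ChiralWindowDoor» Day-1 catalogue (K-a: which explicit flows are homochiral?):
in the periodic Galerkin frame the homochiral steady/decaying examples are exactly the single-shell
Beltrami fields (`BeltramiDecay.beltramiDecay_isGalerkinSolution`: `e^{−νt}V` solves every
truncation), of which ABC is the named instance. WHAT THIS IS NOT: no statement about true
Navier–Stokes dynamics preserving homochirality (it does not: heterochiral triads,
`HelicalTriadInstability`).

## References

* L. Biferale, E. S. Titi, J. Stat. Phys. 151 (2013) 1089–1098 = arXiv:1303.1215, §2.
  [`BiferaleTiti2013`]
* Z. Lei, F.-H. Lin, Y. Zhou, Arch. Ration. Mech. Anal. 218 (2015) 1417–1430 = arXiv:1505.00142,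
  §2 Prop. 2.1 (and the Beltrami example of §1, p. 4). [`LeiLinZhou2015`]
* U. Frisch, *Turbulence*, CUP 1995, (9.4) (ABC flows). [`Frisch1995Turbulence`]
-/

noncomputable section

namespace Literature.Analysis.FluidPDE.FluidComputer

open Complex ComplexConjugate Finset
open scoped BigOperators

namespace ShellTransfer

variable (U : FourierVelocity)

/-- `|k| · |k| = |k|²`. [folklore] -/
private theorem sqrt_knormSq_mul_self' (k : Fin 3 → ℤ) :
    Real.sqrt (knormSq k) * Real.sqrt (knormSq k) = knormSq k :=
  Real.mul_self_sqrt (knormSq_nonneg k)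

/-- `k ≠ 0 ⇒ |k| ≠ 0`. [folklore] -/
private theorem sqrt_knormSq_ne_zero' {k : Fin 3 → ℤ} (hk : k ≠ 0) : Real.sqrt (knormSq k) ≠ 0 := by
  intro h
  have h2 : knormSq k = 0 := by rw [← sqrt_knormSq_mul_self', h, mul_zero]
  exact hk ((knormSq_eq_zero_iff k).mp h2)

/-- **A mode is purely `s`-helical iff it is a Beltrami mode of sign `s`**: for `k ≠ 0` and
`s·s = 1`, `û_{−s}(k) = 0 ↔ ik × û(k) = s|k| û(k)` (the helical vectors are "the eigenvectors of the
curl operator `ik × h± = ±k h±`"). [cite: BiferaleTiti2013, §2 first display (arXiv:1303.1215 p. 4)]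
[cite: LeiLinZhou2015, Prop. 2.1 (arXiv:1505.00142 p. 5)] -/
theorem helicalPart_coeff_eq_zero_iff_curl_eq {s : ℝ} (hs : s * s = 1) {k : Fin 3 → ℤ} (hk : k ≠ 0) :
    (∀ j, (helicalPart (-s) U).coeff k j = 0) ↔
      ∀ j, (curl U).coeff k j = ((s * Real.sqrt (knormSq k) : ℝ) : ℂ) * U.coeff k j := by
  have hr : Real.sqrt (knormSq k) ≠ 0 := sqrt_knormSq_ne_zero' hk
  have hrC : ((Real.sqrt (knormSq k) : ℝ) : ℂ) ≠ 0 := by exact_mod_cast hr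
  have hsC : ((s : ℝ) : ℂ) * ((s : ℝ) : ℂ) = 1 := by exact_mod_cast hs
  constructor
  · intro h j
    -- `û = û_s + û_{-s} = û_s`, and `ik × û = ik × û_s + ik × û_{-s} = s|k| û_s`
    have hU : U.coeff k j = (helicalPart s U).coeff k j := by
      rw [← helicalPart_add_coeff' U s k j, h j, add_zero]
    have hss : (-s) * (-s) = 1 := by rw [neg_mul_neg]; exact hs
    have hcurl : (curl U).coeff k j =
        (curl (helicalPart s U)).coeff k j + (curl (helicalPart (-s) U)).coeff k j := by
      rw [curl_coeff, curl_coeff, curl_coeff]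
      have e : U.coeff k = fun i => (helicalPart s U).coeff k i + (helicalPart (-s) U).coeff k i :=
        funext fun i => (helicalPart_add_coeff' U s k i).symm
      rw [e, kcross_add]
      ring
    rw [hcurl, curl_helicalPart_coeff U hs, curl_helicalPart_coeff U hss, h j, mul_zero, add_zero,
      ← hU]
  · intro h j
    rw [helicalPart_coeff, ← curl_coeff, h j]
    push_cast
    field_simp
    linear_combination (-(U.coeff k j)) * hsC

/-- **Self-curl fields are homochiral**: if `curl V = V` coefficientwise (the Beltrami hypothesis of
`BeltramiDecay`; such a field is carried by the unit shell `|k| = 1`, since `|ik × v̂| = |k||v̂|`),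
then its negative helical component vanishes identically, `V̂₋ ≡ 0`.
[cite: BiferaleTiti2013, §2 (homochiral data `v⁻ = 0`) (arXiv:1303.1215 p. 4)] -/
theorem helicalPart_neg_one_coeff_eq_zero_of_curl_eq_self {V : FourierVelocity}
    (hV : ∀ k j, (curl V).coeff k j = V.coeff k j) (k : Fin 3 → ℤ) (j : Fin 3) :
    (helicalPart (-1) V).coeff k j = 0 := by
  by_cases hk0 : V.coeff k = 0
  · -- a silent mode: both `v̂(k)` and `ik × v̂(k)` vanish
    have h1 : V.coeff k j = 0 := by rw [hk0]; rfl
    rw [helicalPart_coeff, ← curl_coeff, hV k j, h1, mul_zero, add_zero, mul_zero]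
  · -- an active mode lies on the unit shell: `|k|² Σ|v̂|² = Σ|ik × v̂|² = Σ|v̂|²`
    have hE : modalEnergy (curl V) k = modalEnergy V k := by
      unfold modalEnergy
      simp_rw [hV k]
    rw [modalEnergy_curl] at hE
    have hEpos : 0 < modalEnergy V k := by
      unfold modalEnergy
      refine mul_pos (by norm_num) ?_
      obtain ⟨i, hi⟩ : ∃ i, V.coeff k i ≠ 0 := by
        by_contra hall
        exact hk0 (funext fun i => not_not.mp (not_exists.mp hall i))
      exact Finset.sum_pos' (fun _ _ => Complex.normSq_nonneg _)
        ⟨i, Finset.mem_univ _, Complex.normSq_pos.2 hi⟩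
    have hq : knormSq k = 1 := by
      have : (knormSq k - 1) * modalEnergy V k = 0 := by linarith
      rcases mul_eq_zero.mp this with h | h
      · linarith
      · exact absurd h hEpos.ne'
    rw [helicalPart_coeff, ← curl_coeff, hV k j, hq, Real.sqrt_one]
    push_cast
    ring

namespace ABCHat

open ABCFlow

variable (p : Coeffs)

/-- **The ABC datum is purely positively helical**: `(abc)₋ = 0` coefficientwise (it is a self-curl
field, `curl_abc_coeff`; the "maximal helicity" state `H(k) = 2E(k)` of `modalHelicity_abc`).
[cite: BiferaleTiti2013, §2 (homochiral data) (arXiv:1303.1215 p. 4)] -/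
theorem helicalPart_neg_one_abc (k : Fin 3 → ℤ) (j : Fin 3) :
    (helicalPart (-1) (abc p)).coeff k j = 0 :=
  helicalPart_neg_one_coeff_eq_zero_of_curl_eq_self (curl_abc_coeff p) k j

/-- Hence `(abc)₊ = abc` coefficientwise. [cite: BiferaleTiti2013, §2 (arXiv:1303.1215 p. 4)] -/
theorem helicalPart_one_abc (k : Fin 3 → ℤ) (j : Fin 3) :
    (helicalPart 1 (abc p)).coeff k j = (abc p).coeff k j := by
  rw [← helicalPart_add_coeff (abc p) k j, helicalPart_neg_one_abc, add_zero]

end ABCHat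

end ShellTransfer

end Literature.Analysis.FluidPDE.FluidComputer
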